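import Mathlib
import HarnessLib

/-!
# The polar curve's Chern character lies on a SPLIT secant (WEIL-2 gen 30, ANCHOR-G30 §5.5 / Q30.3, fact-free core)

research route, not a corollary; conditional on HC_CM plus one named minimal statement.

Cell `pub-hodge-ring2-ab-*` (ALL ABELIAN VARIETIES), seat WEIL-2 gen 30, account
`run/shared/lean/pub/pub-hodge-ring2/pub-hodge-ring2-ab-weil-2/ANCHOR-G30.md` §5.5 (Q30.3 answered).

Informal setting (not formalised).  On a ppav threefold `(X, Θ)` write `E(λ) = 6·e^{λθ}` truncated,
`E(λ) = 6 + 6λθ + 3λ²θ² + λ³θ³` (`θ⁴ = 0`, `[pt] = θ³/6`).  Markman [arXiv:2502.03415, §1.2–1.4] attaches an abelian sixfold of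
Weil type with field `K = ℚ(λ)` to a sheaf whose Chern character lies on the secant line through the two pure spinors `e^{λθ}, e^{λ̄θ}`;
for an ideal sheaf `I_Z` with `[Z] = m·θ²/2`, `χ(O_Z) = χ`, `ch(I_Z) = 1 − (m/2)θ² − χ[pt]` lies on the secant through `e^{λθ}, e^{μθ}` iff
`λ + μ = χ/m` and `λμ = m` (`secant_combination`), so `λ, μ` are the roots of `T² − (χ/m)T + m`.  For Markman's `d+1` Abel–Jacobi translates
(`m = d+1`, `χ = −2(d+1)`) the roots are `−1 ± √−d`: an imaginary quadratic field (`markman_secant_imaginary`).  For the POLAR CURVE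
`P_w = V(ϑ, ∂_wϑ)` of ANCHOR-G30 (= the coherent double `W₀(c)` at `E³`; `m = 2`, `χ = −6`) — and for every theta-pair intersection
`Θ_u ∩ Θ_v` — the Koszul resolution `0 → L⁻² → E_w^∨ → I_{P_w} → 0` gives `ch(I_{P_w}) = 2e^{−θ} − e^{−2θ} = 1 − θ² + θ³`
(`koszul_ch_polar`), i.e. the secant through the two RATIONAL pure spinors `e^{−θ}, e^{−2θ}` (`polar_secant_split`: `T² + 3T + 2 =
(T+1)(T+2)`): the associated algebra is `ℚ × ℚ`, not a field — no Weil-type structure, no Hodge–Weil class; no twist by `kΘ` changes this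
(the roots shift to `k−1, k−2`, still rational: `polar_secant_split_twisted`).  Hence Q30.3 («can the everywhere-unobstructed jet/Koszul
objects replace the Abel–Jacobi ideals in the secant construction?») is answered NO, and CONE-G29 §4's purity defect `χ/m = −3 ≠ −2` is
the shadow of this rationality.

0 sorry, no `def`, no named fact; `HC_CM` does not occur.
-/

namespace Summit.HodgeConjecture.Ring2AbelianAll.NonsplitSplitSecant

/-- **Koszul Chern character of the polar curve.**  With `E(λ) = 6 + 6λt + 3λ²t² + λ³t³` (six times the truncated exponential):
`2·e^{−t} − e^{−2t} ≡ 1 − t² + t³ (mod t⁴)`, i.e. `2E(−1) − E(−2) = 6(1 − t² + t³)` — the Chern character of `I_{P_w}` from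
`0 → L⁻² → E_w^∨ → I_{P_w} → 0` (`rk E_w = 2`, `E_w` an extension of `L` by `L`): class `θ²` (`m = 2`) and `χ(O_{P_w}) = −6`.
research route, not a corollary; conditional on HC_CM plus one named minimal statement. [locator ANCHOR-G30 §5.5] -/
theorem koszul_ch_polar {R : Type*} [CommRing R] (t : R) :
    2 * (6 + 6 * (-1) * t + 3 * (-1) ^ 2 * t ^ 2 + (-1) ^ 3 * t ^ 3) -
        (6 + 6 * (-2) * t + 3 * (-2) ^ 2 * t ^ 2 + (-2) ^ 3 * t ^ 3) =
      6 * (1 - t ^ 2 + t ^ 3) := by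
  ring

/-- **The secant combination.**  The unique combination of `E(λ)` and `E(μ)` with rank `6·1` and `c₁ = 0` is
`(μE(λ) − λE(μ))/(μ − λ)`, and `μE(λ) − λE(μ) = (μ − λ)(6 − 3λμ·t² − λμ(λ+μ)·t³)`: a class `1 − (m/2)θ² − χ[pt]` lies on the secant
through `e^{λθ}, e^{μθ}` iff `λμ = m` and `λμ(λ+μ) = χ`, i.e. `λ + μ = χ/m` (division-free form; any commutative ring).
research route, not a corollary; conditional on HC_CM plus one named minimal statement. [locator ANCHOR-G30 §5.5] -/
theorem secant_combination {R : Type*} [CommRing R] (l m t : R) :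
    m * (6 + 6 * l * t + 3 * l ^ 2 * t ^ 2 + l ^ 3 * t ^ 3) -
        l * (6 + 6 * m * t + 3 * m ^ 2 * t ^ 2 + m ^ 3 * t ^ 3) =
      (m - l) * (6 - 3 * (l * m) * t ^ 2 - l * m * (l + m) * t ^ 3) := by
  ring

/-- **The polar secant is split.**  For `P_w` (and `Θ_u ∩ Θ_v`): `m = λμ = 2`, `χ = λμ(λ+μ) = −6`, so `λ, μ` are the roots of
`T² + 3T + 2 = (T + 1)(T + 2)`: the rational points `e^{−θ}, e^{−2θ}` of the spinor variety — `K = ℚ × ℚ`, no Weil type.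
research route, not a corollary; conditional on HC_CM plus one named minimal statement. [locator ANCHOR-G30 §5.5] -/
theorem polar_secant_split {R : Type*} [CommRing R] (T : R) :
    T ^ 2 + 3 * T + 2 = (T + 1) * (T + 2) ∧ ((-1 : R) * (-2) = 2 ∧ (-1 : R) * (-2) * ((-1) + (-2)) = -6) := by
  refine ⟨by ring, by norm_num, by norm_num⟩

/-- **Twisting does not help.**  `ch(I_{P_w}(kΘ)) = e^{kθ}(2e^{−θ} − e^{−2θ})` lies on the secant through `e^{(k−1)θ}, e^{(k−2)θ}`:
the roots stay rational for every `k` (`T² − (2k−3)T + (k−1)(k−2) = (T − (k−1))(T − (k−2))`); in particular no integral or rational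
twist produces an imaginary quadratic field (CONE-G29 §4's «(3/2)Ξ» centres the roots at `±½` — still real).
research route, not a corollary; conditional on HC_CM plus one named minimal statement. [locator ANCHOR-G30 §5.5] -/
theorem polar_secant_split_twisted {R : Type*} [CommRing R] (k T : R) :
    T ^ 2 - (2 * k - 3) * T + (k - 1) * (k - 2) = (T - (k - 1)) * (T - (k - 2)) := by
  ring

/-- **Markman's secant is imaginary.**  For `d+1` disjoint Abel–Jacobi translates twisted by `Θ` (`m = d+1`, `χ = −2(d+1)`):
`T² − (χ/m)T + m = T² + 2T + (d+1) = (T+1)² + d` has no root in an ordered field when `d > 0` — the roots `−1 ± √−d` generate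
`K = ℚ(√−d)` ([M] Thm 1.4.1).  The contrast with `polar_secant_split` is ANCHOR-G30's answer to Q30.3.
research route, not a corollary; conditional on HC_CM plus one named minimal statement. [locator ANCHOR-G30 §5.5] -/
theorem markman_secant_imaginary {K : Type*} [Field K] [LinearOrder K] [IsStrictOrderedRing K] (d T : K)
    (hd : 0 < d) :
    T ^ 2 + 2 * T + (d + 1) ≠ 0 := by
  have h : T ^ 2 + 2 * T + (d + 1) = (T + 1) ^ 2 + d := by ring
  rw [h]
  have := sq_nonneg (T + 1)
  linarith

end Summit.HodgeConjecture.Ring2AbelianAll.NonsplitSplitSecant
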